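import Literature.Analysis.FluidPDE.KatoLaiRestart
import Mathlib.Topology.Piecewise
import HarnessLib

/-!
# Kato–Lai in the periodic cylinder: the level-`s` solution on the uniform interval, by restarts

Analysis/FluidPDE support file for the energy-method construction of Euler flows in the
periodic cylinder (`Literature.Analysis.FluidPDE.KatoLai1984_periodicCylinderUniformExistence`;
Kato–Lai 1984, §6, proof of Thm II: the `H^s` solution is continued by restarting Thm I from
`u(T₂)`, the length of the new interval depending only on the `H^{s₀}` size, which stays bounded).
Here the level-`s` problem (`s ≥ 7`) is run on consecutive windows of a fixed length `δ`,
restarting from the re-weighted end state (`KatoLaiRestart`); the pure level-`3` energy of the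
concatenated coefficient path obeys `e₃′ ≤ K e₃^{3/2}` across the junctions, so that
`e₃ ≤ 4Y` up to the time `T♯ = 1/(2K√Y)` (`Y = e₃(0) + 1`, `K = K(L)`), which keeps the restart
data of `H`-norm² at most `4Y + 1` and the window length fixed:

* `lowE g = ∑ p₃(k) ‖g k‖²`, `lowE (i f) = ‖D f‖²`;
* `Windows hL s δ Mb G j` — `j` consecutive windows of solutions in duality form behind the
  coefficient path `G`; `Windows.lowE_le` — the comparison `e₃ ≤ 4Y` on `[0, min (jδ) T♯]`;
  `Windows.succ` — one more window while `jδ ≤ T♯`; `exists_windows` — any number of windows;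
* `exists_isCellPath` — **the level-`s` cell path on `[0, T♯]`** (an `IsCellPath` of
  `KatoLaiRestart`, represented at level `s` at every time, with `e₃ ≤ 4Y`).

Everything is proved; no named fact and no `sorry` is introduced.

## References

* T. Kato, C. Y. Lai, J. Funct. Anal. 56 (1984) 15–28, §6. [KatoLai1984]
-/

noncomputable section

open MeasureTheory Set Function Filter Topology TopologicalSpace
open scoped NNReal ENNReal InnerProductSpace RealInnerProductSpace

namespace Literature.Analysis.FluidPDE

open FunctionSpaces FunctionSpaces.Torus UnitAddTorus

/-- Local notation for physical space `ℝ³ = EuclideanSpace ℝ (Fin 3)`. -/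
local notation "ℝ³" => EuclideanSpace ℝ (Fin 3)

namespace PeriodicCylinder

variable {L : ℝ} (hL : 0 < L)

/-! ### The level-`3` energy of a coefficient family -/

/-- The pure level-`3` energy of a (weight-`1`) coefficient family: `∑ p₃(k) ‖g k‖²` (junk `0` if
the series diverges). [folklore] -/
def lowE (g : SymL2 (Fin 3)) : ℝ := ∑' k, pureSq 3 k * ‖g k‖ ^ 2

/-- **`lowE (i f) = ‖D f‖²`.** [folklore] -/
theorem lowE_embed (s : ℕ) (ε : ℝ) (f : SymL2 (Fin 3)) : lowE (embed s ε f) = ‖d3Op s ε f‖ ^ 2 := by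
  have h := SymL2.hasSum_norm_sq_diag (d3Symbol s ε) (abs_d3Symbol_le s ε) (d3Symbol_neg s ε) f
  rw [lowE, d3Op, ← h.tsum_eq]
  refine tsum_congr fun k => ?_
  rw [embed_apply, norm_smul, d3Symbol, mul_pow, mul_pow, Real.sq_sqrt (zero_le_one.trans (one_le_pureSq 3 k))]
  have hw := klWeight_pos s ε k
  rw [show ‖((klWeight s ε k)⁻¹ : ℂ)‖ = (klWeight s ε k)⁻¹ by
    rw [norm_inv, Complex.norm_real, Real.norm_of_nonneg hw.le], inv_pow]
  ring

/-! ### Gluing continuous paths -/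

/-- Gluing two continuous paths at a junction where they agree. [folklore] -/
theorem continuousOn_glue {E : Type*} [TopologicalSpace E] {f g : ℝ → E} {a b c : ℝ}
    (hf : ContinuousOn f (Icc a b)) (hg : ContinuousOn g (Icc b c)) (hfg : f b = g b) :
    ContinuousOn (fun t => if t ≤ b then f t else g t) (Icc a c) := by
  refine ContinuousOn.if ?_ ?_ ?_
  · rintro t ⟨-, ht⟩
    rw [show {x : ℝ | x ≤ b} = Iic b from rfl, frontier_Iic] at ht
    rw [mem_singleton_iff.1 ht]
    exact hfg
  · rw [show {x : ℝ | x ≤ b} = Iic b from rfl, closure_Iic]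
    exact hf.mono fun t ht => ⟨ht.1.1, ht.2⟩
  · rw [show {x : ℝ | ¬x ≤ b} = Ioi b by ext; simp, closure_Ioi]
    exact hg.mono fun t ht => ⟨ht.2, ht.1.2⟩

/-! ### The derivative bound of the level-`3` energy, packaged -/

/-- The derivative bound `e₃′ ≤ K ‖D u‖³` along any level-`s` solution (`s ≥ 7`, `ε ≠ 0`), with
`K = K(L) > 0`. [cite: KatoLai1984, §5 (5.8)] -/
theorem exists_lowerEnergy_deriv_le : ∃ K : ℝ, 0 < K ∧ ∀ (s : ℕ) (ε : ℝ) (hs : 6 ≤ s) (hε : ε ≠ 0), 7 ≤ s →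
    ∀ {φ : SymL2 (Fin 3)} {T : ℝ} {u : ℝ → SymL2 (Fin 3)}, KatoLai.IsFormSolution (embed s ε) (klForm hL s ε) φ T u → 0 ≤ T →
      ∀ t ∈ Icc 0 T, HasDerivWithinAt (fun τ => ‖d3Op s ε (u τ)‖ ^ 2) (-(2 * ⟪klOpExt hL s ε (u t), d3pOp hs hε (u t)⟫_ℝ)) (Icc 0 T) t ∧
        -(2 * ⟪klOpExt hL s ε (u t), d3pOp hs hε (u t)⟫_ℝ) ≤ K * ‖d3Op s ε (u t)‖ ^ 3 := by
  obtain ⟨K₃, hK₃0, hK₃⟩ := exists_abs_inner_klOpExt_d3pOp_le hL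
  refine ⟨256 * K₃ + 1, by positivity, fun s ε hs hε hs7 φ T u hu hT t ht => ⟨hasDerivWithinAt_lowerEnergy hL hs hε hs7 hu hT ht, ?_⟩⟩
  have h := hK₃ s ε hs hε (u t)
  have hn : 0 ≤ ‖d3Op s ε (u t)‖ := norm_nonneg _
  have h1 := neg_abs_le (2 * ⟪klOpExt hL s ε (u t), d3pOp hs hε (u t)⟫_ℝ)
  rw [abs_mul, abs_two] at h1
  nlinarith [pow_nonneg hn 3]

/-! ### Families of windows -/

section Win

variable (s : ℕ) (δ Mb : ℝ)

/-- **`j` consecutive windows** of length `δ` behind the coefficient path `G`: on the `i`-th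
window `G (iδ + τ) = i (u_i τ)` for a solution in duality form `u_i` of the level-`s` problem at
some `ε_i > 0`, of `H`-norm² at most `Mb`, with vanishing gradient part; `G` and its level-`3`
energy are continuous on `[0, jδ]`. [cite: KatoLai1984, §6] -/
structure Windows (G : ℝ → SymL2 (Fin 3)) (j : ℕ) : Prop where
  /-- the windows -/
  win : ∀ i : ℕ, i < j → ∃ (ε : ℝ) (φ : SymL2 (Fin 3)) (u : ℝ → SymL2 (Fin 3)), 0 < ε ∧
    KatoLai.IsFormSolution (embed s ε) (klForm hL s ε) φ δ u ∧
    (∀ τ ∈ Icc 0 δ, G (i * δ + τ) = embed s ε (u τ)) ∧ (∀ τ ∈ Icc 0 δ, ‖u τ‖ ^ 2 ≤ Mb) ∧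
    (∀ τ ∈ Icc 0 δ, helmholtzProj L (cellRestrict hL (G (i * δ + τ))) = 0)
  /-- continuity of the path -/
  cont : ContinuousOn G (Icc 0 (j * δ))
  /-- continuity of the level-`3` energy -/
  econt : ContinuousOn (fun t => lowE (G t)) (Icc 0 (j * δ))
  /-- the end state is represented at level `s` and has no gradient part -/
  tail : ∃ (ε : ℝ) (f : SymL2 (Fin 3)), 0 < ε ∧ G (j * δ) = embed s ε f ∧ helmholtzProj L (cellRestrict hL (G (j * δ))) = 0

end Win

/-- Locating a time in its window. [folklore] -/
theorem exists_window_index {δ : ℝ} (hδ : 0 < δ) {j : ℕ} {t : ℝ} (ht0 : 0 ≤ t) (ht : t < j * δ) :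
    ∃ i : ℕ, i < j ∧ (i : ℝ) * δ ≤ t ∧ t < (i + 1) * δ := by
  refine ⟨⌊t / δ⌋₊, ?_, ?_, ?_⟩
  · have h1 : (⌊t / δ⌋₊ : ℝ) ≤ t / δ := Nat.floor_le (div_nonneg ht0 hδ.le)
    have h2 : t / δ < j := by rwa [div_lt_iff₀ hδ]
    exact_mod_cast h1.trans_lt h2
  · have h1 : (⌊t / δ⌋₊ : ℝ) ≤ t / δ := Nat.floor_le (div_nonneg ht0 hδ.le)
    rwa [le_div_iff₀ hδ] at h1
  · have h1 : t / δ < ⌊t / δ⌋₊ + 1 := Nat.lt_floor_add_one _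
    rwa [div_lt_iff₀ hδ] at h1

/-- Locating a positive time in the window to its left. [folklore] -/
theorem exists_window_index_left {δ : ℝ} (hδ : 0 < δ) {j : ℕ} {t : ℝ} (ht0 : 0 < t) (ht : t ≤ j * δ) :
    ∃ i : ℕ, i < j ∧ (i : ℝ) * δ < t ∧ t ≤ (i + 1) * δ := by
  have hc1 : 1 ≤ ⌈t / δ⌉₊ := Nat.one_le_iff_ne_zero.2 (by
    intro h; rw [Nat.ceil_eq_zero, div_le_iff₀ hδ, zero_mul] at h; linarith)
  refine ⟨⌈t / δ⌉₊ - 1, ?_, ?_, ?_⟩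
  · have h1 : (⌈t / δ⌉₊ : ℝ) < t / δ + 1 := Nat.ceil_lt_add_one (div_nonneg ht0.le hδ.le)
    have h2 : t / δ ≤ j := by rwa [div_le_iff₀ hδ]
    have : (⌈t / δ⌉₊ : ℝ) < j + 1 := by linarith
    have : ⌈t / δ⌉₊ < j + 1 := by exact_mod_cast this
    omega
  · have h1 : (⌈t / δ⌉₊ : ℝ) < t / δ + 1 := Nat.ceil_lt_add_one (div_nonneg ht0.le hδ.le)
    rw [Nat.cast_sub hc1, Nat.cast_one]
    have : ((⌈t / δ⌉₊ : ℝ) - 1) < t / δ := by linarith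
    rwa [lt_div_iff₀ hδ] at this
  · have h1 : t / δ ≤ ⌈t / δ⌉₊ := Nat.le_ceil _
    rw [Nat.cast_sub hc1, Nat.cast_one, sub_add_cancel]
    rwa [div_le_iff₀ hδ] at h1

/-! ### The comparison argument, abstractly -/

/-- **Comparison with `Y/(1 − K√Y t)²`**: a continuous `f ≥ 0` on `[0, T′]` with right
derivatives `f′ ≤ K f √f`, `f 0 + 1 ≤ Y`, and `T′ ≤ 1/(2K√Y)` satisfies `f ≤ 4Y`. [folklore] -/
theorem le_four_of_deriv_right_le {f f' : ℝ → ℝ} {T' K Y : ℝ} (hK : 0 < K) (hY : 0 < Y) (hf0 : f 0 ≤ Y)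
    (hfc : ContinuousOn f (Icc 0 T')) (hfd : ∀ x ∈ Ico 0 T', HasDerivWithinAt f (f' x) (Ici x) x)
    (hb : ∀ x ∈ Ico 0 T', f' x ≤ K * (f x * Real.sqrt (f x)))
    (hT' : T' ≤ 1 / (2 * (K * Real.sqrt Y))) : ∀ t ∈ Icc 0 T', f t ≤ 4 * Y := by
  set c : ℝ := K * Real.sqrt Y with hc
  have hcpos : 0 < c := by positivity
  set B : ℝ → ℝ := fun τ => Y / (1 - c * τ) ^ 2 with hB
  set B' : ℝ → ℝ := fun τ => 2 * c * Y / (1 - c * τ) ^ 3 with hB'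
  have hden : ∀ τ ∈ Icc 0 T', 1 / 2 ≤ 1 - c * τ := fun τ hτ => by
    have h1 : τ ≤ 1 / (2 * c) := hτ.2.trans hT'
    have h2 : c * τ ≤ c * (1 / (2 * c)) := mul_le_mul_of_nonneg_left h1 hcpos.le
    rw [show c * (1 / (2 * c)) = 1 / 2 by field_simp] at h2
    linarith
  have hBd : ∀ τ ∈ Icc 0 T', HasDerivAt B (B' τ) τ := fun τ hτ => by
    have hpos : 0 < 1 - c * τ := lt_of_lt_of_le (by norm_num) (hden τ hτ)
    have hlin : HasDerivAt (fun σ => 1 - c * σ) (-c) τ := by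
      simpa using ((hasDerivAt_id τ).const_mul c).const_sub 1
    have h1 : HasDerivAt (fun σ => (1 - c * σ) ^ 2) (2 * (1 - c * τ) * (-c)) τ := by
      refine (hlin.pow 2).congr_deriv ?_
      norm_num
    have h2 := (h1.inv (pow_ne_zero 2 hpos.ne')).const_mul Y
    have e : Y * (-(2 * (1 - c * τ) * -c) / ((1 - c * τ) ^ 2) ^ 2) = B' τ := by
      rw [hB']; simp only; field_simp
    rw [← e]
    refine h2.congr_of_eventuallyEq (Eventually.of_forall fun σ => ?_)
    rw [hB]; simp only [Pi.inv_apply, div_eq_mul_inv]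
  have hBc : ContinuousOn B (Icc 0 T') := fun τ hτ => (hBd τ hτ).continuousAt.continuousWithinAt
  have hBd' : ∀ x ∈ Ico 0 T', HasDerivWithinAt B (B' x) (Ici x) x := fun x hx => (hBd x ⟨hx.1, hx.2.le⟩).hasDerivWithinAt
  have hfB0 : f 0 ≤ B 0 := by
    rw [hB]; simp only; rw [mul_zero, sub_zero, one_pow, div_one]; exact hf0
  have hbound : ∀ x ∈ Ico 0 T', f x = B x → f' x < B' x := by
    intro x hx hfx
    have hxI : x ∈ Icc 0 T' := ⟨hx.1, hx.2.le⟩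
    have hpos : 0 < 1 - c * x := lt_of_lt_of_le (by norm_num) (hden x hxI)
    have hBx : B x = Y / (1 - c * x) ^ 2 := rfl
    have hsB : Real.sqrt (B x) = Real.sqrt Y / (1 - c * x) := by
      rw [hBx, Real.sqrt_div hY.le, Real.sqrt_sq hpos.le]
    calc f' x ≤ K * (f x * Real.sqrt (f x)) := hb x hx
      _ = K * (B x * Real.sqrt (B x)) := by rw [hfx]
      _ = c * Y / (1 - c * x) ^ 3 := by rw [hsB, hBx, hc]; field_simp
      _ < 2 * c * Y / (1 - c * x) ^ 3 := by
          rw [div_lt_div_iff_of_pos_right (pow_pos hpos 3)]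
          nlinarith
      _ = B' x := rfl
  intro t ht
  have hle := image_le_of_deriv_right_lt_deriv_boundary' hfc hfd hfB0 hBc hBd' hbound ht
  have hd := hden t ht
  have hpos : 0 < 1 - c * t := lt_of_lt_of_le (by norm_num) hd
  have hBt : B t ≤ 4 * Y := by
    show Y / (1 - c * t) ^ 2 ≤ 4 * Y
    rw [div_le_iff₀ (pow_pos hpos 2)]
    have hq : (1 / 2 : ℝ) ^ 2 ≤ (1 - c * t) ^ 2 := pow_le_pow_left₀ (by norm_num) hd 2
    nlinarith
  exact hle.trans hBt

/-! ### The constant and the uniform time -/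

/-- The constant `K(L)` of the level-`3` derivative bound. [folklore] -/
def lowK (hL : 0 < L) : ℝ := Classical.choose (exists_lowerEnergy_deriv_le hL)

/-- `0 < lowK`. [folklore] -/
theorem lowK_pos : 0 < lowK hL := (Classical.choose_spec (exists_lowerEnergy_deriv_le hL)).1

/-- The defining property of `lowK`. [folklore] -/
theorem lowK_spec (s : ℕ) (ε : ℝ) (hs : 6 ≤ s) (hε : ε ≠ 0) (hs7 : 7 ≤ s) {φ : SymL2 (Fin 3)} {T : ℝ} {u : ℝ → SymL2 (Fin 3)}
    (hu : KatoLai.IsFormSolution (embed s ε) (klForm hL s ε) φ T u) (hT : 0 ≤ T) {t : ℝ} (ht : t ∈ Icc 0 T) :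
    HasDerivWithinAt (fun τ => ‖d3Op s ε (u τ)‖ ^ 2) (-(2 * ⟪klOpExt hL s ε (u t), d3pOp hs hε (u t)⟫_ℝ)) (Icc 0 T) t ∧
      -(2 * ⟪klOpExt hL s ε (u t), d3pOp hs hε (u t)⟫_ℝ) ≤ lowK hL * ‖d3Op s ε (u t)‖ ^ 3 :=
  (Classical.choose_spec (exists_lowerEnergy_deriv_le hL)).2 s ε hs hε hs7 hu hT t ht

/-- **The uniform time** `T♯(Y) = 1 / (2 K √Y)`. [cite: KatoLai1984, Thm I (uniformity clause)] -/
def sharpTime (hL : 0 < L) (Y : ℝ) : ℝ := 1 / (2 * (lowK hL * Real.sqrt Y))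

/-- `0 < T♯` for `0 < Y`. [folklore] -/
theorem sharpTime_pos {Y : ℝ} (hY : 0 < Y) : 0 < sharpTime hL Y := by
  unfold sharpTime; have := lowK_pos hL; positivity

/-! ### The level-`3` energy along a family of windows -/

/-- `lowE ≥ 0`. [folklore] -/
theorem lowE_nonneg (g : SymL2 (Fin 3)) : 0 ≤ lowE g :=
  tsum_nonneg fun k => mul_nonneg (zero_le_one.trans (one_le_pureSq 3 k)) (sq_nonneg _)

/-- **The comparison along the windows**: with `Y = lowE (G 0) + 1`, `lowE (G t) ≤ 4Y` for
`t ∈ [0, jδ]` with `t ≤ T♯(Y)` (`s ≥ 7`). [cite: KatoLai1984, §6] -/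
theorem Windows.lowE_le {s : ℕ} {δ Mb : ℝ} {G : ℝ → SymL2 (Fin 3)} {j : ℕ} (hW : Windows hL s δ Mb G j) (hδ : 0 < δ)
    (hs7 : 7 ≤ s) {t : ℝ} (ht : t ∈ Icc 0 (j * δ)) (htT : t ≤ sharpTime hL (lowE (G 0) + 1)) :
    lowE (G t) ≤ 4 * (lowE (G 0) + 1) := by
  have hs6 : 6 ≤ s := by omega
  set Y := lowE (G 0) + 1 with hY
  have hYpos : 0 < Y := by have := lowE_nonneg (G 0); positivity
  set T' : ℝ := min (j * δ) (sharpTime hL Y) with hT'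
  have htT' : t ∈ Icc 0 T' := ⟨ht.1, le_min ht.2 htT⟩
  set f : ℝ → ℝ := fun τ => lowE (G τ) with hf
  have hT'j : T' ≤ j * δ := min_le_left _ _
  have hfc : ContinuousOn f (Icc 0 T') := hW.econt.mono (Icc_subset_Icc le_rfl hT'j)
  -- right derivatives from the windows
  have hder : ∀ x ∈ Ico 0 T', ∃ f'x : ℝ, HasDerivWithinAt f f'x (Ici x) x ∧ f'x ≤ lowK hL * (f x * Real.sqrt (f x)) := by
    intro x hx
    obtain ⟨i, hij, hix, hxi⟩ := exists_window_index hδ hx.1 (hx.2.trans_le hT'j)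
    obtain ⟨ε, φ, u, hε, hu, hG, -, -⟩ := hW.win i hij
    set τ₀ := x - i * δ with hτ₀
    have hτ₀I : τ₀ ∈ Icc 0 δ := ⟨by rw [hτ₀]; linarith, by rw [hτ₀]; linarith⟩
    obtain ⟨hd, hb⟩ := lowK_spec hL s ε hs6 hε.ne' hs7 hu hδ.le hτ₀I
    -- transport the derivative to `f` within `Icc (iδ) (iδ + δ)` at `x`
    have hsh : HasDerivWithinAt (fun t' : ℝ => t' - i * δ) 1 (Icc (i * δ) (i * δ + δ)) x := by
      simpa using ((hasDerivAt_id x).sub_const ((i : ℝ) * δ)).hasDerivWithinAt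
    have hmaps : MapsTo (fun t' : ℝ => t' - i * δ) (Icc (i * δ) (i * δ + δ)) (Icc 0 δ) := fun t' ht' =>
      ⟨by linarith [ht'.1], by linarith [ht'.2]⟩
    have hcomp := hd.comp x hsh hmaps
    rw [mul_one] at hcomp
    have hmem : Icc (i * δ) (i * δ + δ) ∈ 𝓝[Ici x] x :=
      mem_of_superset (Icc_mem_nhdsGE (by linarith : x < i * δ + δ)) (Icc_subset_Icc hix le_rfl)
    have hcomp' := hcomp.mono_of_mem_nhdsWithin hmem
    -- `f = (‖D u (· − iδ)‖²)` on that window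
    have hfeq : ∀ t' ∈ Icc (i * δ) (i * δ + δ), f t' = ‖d3Op s ε (u (t' - i * δ))‖ ^ 2 := by
      intro t' ht'
      have h1 := hG (t' - i * δ) (hmaps ht')
      rw [show (i : ℝ) * δ + (t' - i * δ) = t' by ring] at h1
      rw [hf]; simp only; rw [h1, lowE_embed]
    have hfx : f x = ‖d3Op s ε (u τ₀)‖ ^ 2 := hfeq x ⟨hix, by linarith⟩
    refine ⟨_, hcomp'.congr_of_eventuallyEq ?_ ?_, ?_⟩
    · filter_upwards [hmem] with t' ht'
      exact hfeq t' ht'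
    · simpa [hτ₀] using hfx
    · have hn : 0 ≤ ‖d3Op s ε (u τ₀)‖ := norm_nonneg _
      have e3 : ‖d3Op s ε (u τ₀)‖ ^ 3 = f x * Real.sqrt (f x) := by
        rw [hfx, Real.sqrt_sq hn]; ring
      rw [← e3]
      exact hb
  choose! f' hf'd hf'b using hder
  have hf0 : f 0 ≤ Y := by rw [hY]; show lowE (G 0) ≤ lowE (G 0) + 1; linarith
  have hres := le_four_of_deriv_right_le (lowK_pos hL) hYpos hf0 hfc hf'd hf'b (min_le_right _ _) t htT'
  exact hres

/-! ### The run constant and the window length -/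

section Run

variable {s : ℕ} (hs : 3 ≤ s)

/-- The constant `K_s(L)` of the coercivity bound at level `s`. [folklore] -/
def runK (hL : 0 < L) (hs : 3 ≤ s) : ℝ := Classical.choose (exists_formSolution_klForm hL hs)

/-- `0 ≤ runK`. [folklore] -/
theorem runK_nonneg : 0 ≤ runK hL hs := (Classical.choose_spec (exists_formSolution_klForm hL hs)).1

/-- The defining property of `runK`: the run of Theorem A. [cite: KatoLai1984, §3 Thm A, §5] -/
theorem runK_spec (ε M' : ℝ) (hM' : 0 ≤ M') (φ : SymL2 (Fin 3)) (hφ : ‖φ‖ ^ 2 ≤ M') :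
    ∃ u : ℝ → SymL2 (Fin 3), KatoLai.IsFormSolution (embed s ε) (klForm hL s ε) φ (2 * runK hL hs * (M' + 2) ^ 2 + 1)⁻¹ u ∧
      ∀ t ∈ Icc 0 (2 * runK hL hs * (M' + 2) ^ 2 + 1)⁻¹, ‖u t‖ ^ 2 ≤ M' + 1 :=
  (Classical.choose_spec (exists_formSolution_klForm hL hs)).2 ε M' hM' φ hφ

/-- **The window length** at level `s` for level-`3` size `Y`: the existence time of Theorem A
for data of `H`-norm² at most `4Y + 1`. [cite: KatoLai1984, §6] -/
def winLen (hL : 0 < L) (hs : 3 ≤ s) (Y : ℝ) : ℝ := (2 * runK hL hs * (4 * Y + 1 + 2) ^ 2 + 1)⁻¹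

/-- `0 < winLen`. [folklore] -/
theorem winLen_pos (Y : ℝ) : 0 < winLen hL hs Y := by
  unfold winLen; have := runK_nonneg hL hs; positivity

end Run

/-! ### One more window -/

section Step

variable {s : ℕ} (hs : 3 ≤ s) (hs7 : 7 ≤ s)
include hs7

/-- **The restart step**: `j` windows and `jδ ≤ T♯` give `j + 1` windows, with the same path on
`[0, jδ]`. [cite: KatoLai1984, §6 (proof of Thm II)] -/
theorem Windows.succ {G : ℝ → SymL2 (Fin 3)} {j : ℕ}
    (hW : Windows hL s (winLen hL hs (lowE (G 0) + 1)) (4 * (lowE (G 0) + 1) + 1 + 1) G j)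
    (hj : (j : ℝ) * winLen hL hs (lowE (G 0) + 1) ≤ sharpTime hL (lowE (G 0) + 1)) :
    ∃ G' : ℝ → SymL2 (Fin 3), G' 0 = G 0 ∧ (∀ t ≤ (j : ℝ) * winLen hL hs (lowE (G 0) + 1), G' t = G t) ∧
      Windows hL s (winLen hL hs (lowE (G 0) + 1)) (4 * (lowE (G 0) + 1) + 1 + 1) G' (j + 1) := by
  have hs6 : 6 ≤ s := by omega
  set Y := lowE (G 0) + 1 with hY
  have hYpos : 0 < Y := by have := lowE_nonneg (G 0); positivity
  set δ := winLen hL hs Y with hδdef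
  have hδ : 0 < δ := winLen_pos hL hs Y
  set M' : ℝ := 4 * Y + 1 with hM'
  -- the end state and its level-`3` energy
  obtain ⟨ε, f, hε, hGj, hQj⟩ := hW.tail
  have hjI : (j : ℝ) * δ ∈ Icc 0 ((j : ℝ) * δ) := ⟨by positivity, le_rfl⟩
  have he3 : ‖d3Op s ε f‖ ^ 2 ≤ 4 * Y := by
    rw [← lowE_embed, ← hGj]; exact hW.lowE_le hL hδ hs7 hjI hj
  -- the restart datum
  obtain ⟨ε₁, hε₁, hε₁le, hε₁S⟩ := exists_restart_eps s hε.ne' f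
  rw [abs_of_pos hε] at hε₁le
  set φ' := reweight s hε₁ hε₁le f with hφ'
  have hφ'n : ‖φ'‖ ^ 2 ≤ M' := by
    rw [hφ', norm_reweight_sq s hε₁ hε₁le hε.ne', hM']; linarith
  -- the run
  obtain ⟨u, hu, hub⟩ := runK_spec hL hs ε₁ M' (by positivity) φ' hφ'n
  have hδrun : (2 * runK hL hs * (M' + 2) ^ 2 + 1)⁻¹ = δ := by rw [hδdef, winLen, hM']
  rw [hδrun] at hu hub
  -- the new path
  set G' : ℝ → SymL2 (Fin 3) := fun t => if t ≤ (j : ℝ) * δ then G t else embed s ε₁ (u (t - j * δ)) with hG'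
  have hG'le : ∀ t ≤ (j : ℝ) * δ, G' t = G t := fun t ht => by rw [hG']; simp only; rw [if_pos ht]
  have hjunction : G ((j : ℝ) * δ) = embed s ε₁ (u 0) := by
    rw [hGj, hu.initial, hφ', embed_reweight]
  have hG'win : ∀ τ ∈ Icc 0 δ, G' ((j : ℝ) * δ + τ) = embed s ε₁ (u τ) := by
    intro τ hτ
    rcases hτ.1.eq_or_lt with h | h
    · rw [← h, add_zero, hG'le _ le_rfl, hjunction]
    · rw [hG']; simp only; rw [if_neg (by linarith), show (j : ℝ) * δ + τ - j * δ = τ by ring]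
  -- the gradient part vanishes along the new window
  have hQ0 : helmholtzProj L (velCell hL s ε₁ u 0) = 0 := by
    rw [velCell, klVel, ← hjunction]; exact hQj
  have hQwin : ∀ τ ∈ Icc 0 δ, helmholtzProj L (cellRestrict hL (G' ((j : ℝ) * δ + τ))) = 0 := fun τ hτ => by
    rw [hG'win τ hτ]; exact helmholtzProj_velCell_eq_zero hL s ε₁ hu hδ.le hQ0 hτ
  refine ⟨G', hG'le 0 (by positivity), hG'le, ⟨?_, ?_, ?_, ?_⟩⟩
  · -- windows
    intro i hi
    rcases Nat.lt_succ_iff_lt_or_eq.1 hi with hlt | heq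
    · obtain ⟨εi, φi, ui, hεi, hui, hGi, hbi, hQi⟩ := hW.win i hlt
      have hle' : ∀ τ ∈ Icc 0 δ, (i : ℝ) * δ + τ ≤ j * δ := fun τ hτ => by
        have : (i : ℝ) + 1 ≤ j := by exact_mod_cast hlt
        nlinarith [hτ.2]
      refine ⟨εi, φi, ui, hεi, hui, fun τ hτ => ?_, hbi, fun τ hτ => ?_⟩
      · rw [hG'le _ (hle' τ hτ)]; exact hGi τ hτ
      · rw [hG'le _ (hle' τ hτ)]; exact hQi τ hτ
    · subst heq
      refine ⟨ε₁, φ', u, hε₁, hu, hG'win, fun τ hτ => ?_, hQwin⟩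
      have := hub τ hτ; rw [hM'] at this; linarith
  · -- continuity of the path
    have hcast : ((j + 1 : ℕ) : ℝ) * δ = j * δ + δ := by push_cast; ring
    rw [hcast]
    refine continuousOn_glue hW.cont ?_ ?_
    · obtain ⟨R, hR0, hR⟩ := exists_norm_klVel_sub_le hL s ε₁ hu hδ.le
      have hmaps : MapsTo (fun t : ℝ => t - j * δ) (Icc ((j : ℝ) * δ) (j * δ + δ)) (Icc 0 δ) := fun t ht =>
        ⟨by linarith [ht.1], by linarith [ht.2]⟩
      have hc : ContinuousOn (klVel s ε₁ u) (Icc 0 δ) := by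
        refine Metric.continuousOn_iff.2 fun τ hτ η hη => ⟨η / (R + 1), by positivity, fun τ' hτ' hd => ?_⟩
        rw [dist_eq_norm] at hd ⊢
        calc ‖klVel s ε₁ u τ' - klVel s ε₁ u τ‖ ≤ R * |τ' - τ| := hR τ' hτ' τ hτ
          _ ≤ (R + 1) * |τ' - τ| := mul_le_mul_of_nonneg_right (by linarith) (abs_nonneg _)
          _ < (R + 1) * (η / (R + 1)) := mul_lt_mul_of_pos_left (by rwa [Real.norm_eq_abs] at hd) (by positivity)
          _ = η := mul_div_cancel₀ η (by positivity)
      exact hc.comp (continuous_id.sub continuous_const).continuousOn hmaps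
    · rw [hjunction, sub_self]
  · -- continuity of the energy
    have hcast : ((j + 1 : ℕ) : ℝ) * δ = j * δ + δ := by push_cast; ring
    rw [hcast]
    have heq : ∀ t, lowE (G' t) = if t ≤ (j : ℝ) * δ then lowE (G t) else ‖d3Op s ε₁ (u (t - j * δ))‖ ^ 2 := by
      intro t; rw [hG']; simp only; split_ifs <;> [rfl; exact lowE_embed s ε₁ _]
    simp_rw [heq]
    refine continuousOn_glue hW.econt ?_ ?_
    · have hmaps : MapsTo (fun t : ℝ => t - j * δ) (Icc ((j : ℝ) * δ) (j * δ + δ)) (Icc 0 δ) := fun t ht =>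
        ⟨by linarith [ht.1], by linarith [ht.2]⟩
      have hc : ContinuousOn (fun τ => ‖d3Op s ε₁ (u τ)‖ ^ 2) (Icc 0 δ) := fun τ hτ =>
        (lowK_spec hL s ε₁ hs6 hε₁.ne' hs7 hu hδ.le hτ).1.continuousWithinAt
      exact hc.comp (continuous_id.sub continuous_const).continuousOn hmaps
    · rw [hGj, lowE_embed, sub_self, hu.initial, hφ', d3Op_reweight]
  · -- the end state
    have hcast : ((j + 1 : ℕ) : ℝ) * δ = j * δ + δ := by push_cast; ring
    refine ⟨ε₁, u δ, hε₁, ?_, ?_⟩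
    · rw [hcast]; exact hG'win δ ⟨hδ.le, le_rfl⟩
    · rw [hcast]; exact hQwin δ ⟨hδ.le, le_rfl⟩

/-- **Any number of windows** behind a path starting from a level-`s` datum without gradient part,
as long as they begin before `T♯`. [cite: KatoLai1984, §6] -/
theorem exists_windows {ε₀ : ℝ} (hε₀ : 0 < ε₀) (f₀ : SymL2 (Fin 3))
    (hQ0 : helmholtzProj L (cellRestrict hL (embed s ε₀ f₀)) = 0) (j : ℕ)
    (hj : (j : ℝ) * winLen hL hs (lowE (embed s ε₀ f₀) + 1) ≤ sharpTime hL (lowE (embed s ε₀ f₀) + 1) + winLen hL hs (lowE (embed s ε₀ f₀) + 1)) :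
    ∃ G : ℝ → SymL2 (Fin 3), G 0 = embed s ε₀ f₀ ∧
      Windows hL s (winLen hL hs (lowE (G 0) + 1)) (4 * (lowE (G 0) + 1) + 1 + 1) G j := by
  induction j with
  | zero =>
    refine ⟨fun _ => embed s ε₀ f₀, rfl, ⟨fun i hi => absurd hi (Nat.not_lt_zero i), ?_, ?_, ?_⟩⟩
    · exact continuousOn_const
    · exact continuousOn_const
    · exact ⟨ε₀, f₀, hε₀, rfl, hQ0⟩
  | succ j ih =>
    have hδ := winLen_pos hL hs (lowE (embed s ε₀ f₀) + 1)
    have hj' : (j : ℝ) * winLen hL hs (lowE (embed s ε₀ f₀) + 1) ≤ sharpTime hL (lowE (embed s ε₀ f₀) + 1) := by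
      push_cast at hj; linarith
    obtain ⟨G, hG0, hW⟩ := ih (by linarith)
    rw [← hG0] at hj'
    obtain ⟨G', hG'0, -, hW'⟩ := hW.succ hL hs hs7 hj'
    refine ⟨G', by rw [hG'0, hG0], ?_⟩
    rw [show lowE (G' 0) = lowE (G 0) by rw [hG'0]]
    exact hW'

end Step

/-! ### The level-`s` cell path on the uniform interval -/

section Final

variable {s : ℕ} (hs7 : 7 ≤ s)
include hs7

/-- **The level-`s` solution on `[0, T♯]`** (Kato–Lai Thm I with the uniformity clause, and the
restart argument of Thm II): from a level-`s` datum `i f₀` (`ε₀ > 0`) without gradient part, a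
coefficient path `G` on `[0, T♯(Y)]`, `Y = lowE (i f₀) + 1`, continuous, starting at `i f₀`, whose
cell restriction is a cell path (`KatoLaiRestart.IsCellPath`) with bound `√(4Y + 3)`, represented
at level `s` at every time, with level-`3` energy at most `4Y`. [cite: KatoLai1984, Thm I, Thm II, §6] -/
theorem exists_levelPath {ε₀ : ℝ} (hε₀ : 0 < ε₀) (f₀ : SymL2 (Fin 3))
    (hQ0 : helmholtzProj L (cellRestrict hL (embed s ε₀ f₀)) = 0) :
    ∃ G : ℝ → SymL2 (Fin 3), G 0 = embed s ε₀ f₀ ∧ ContinuousOn G (Icc 0 (sharpTime hL (lowE (embed s ε₀ f₀) + 1))) ∧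
      IsCellPath hL (Real.sqrt (4 * (lowE (embed s ε₀ f₀) + 1) + 1 + 1)) (sharpTime hL (lowE (embed s ε₀ f₀) + 1))
        (fun t => cellRestrict hL (G t)) ∧
      (∀ t ∈ Icc 0 (sharpTime hL (lowE (embed s ε₀ f₀) + 1)), ∃ (ε : ℝ) (f : SymL2 (Fin 3)),
        0 < ε ∧ ‖f‖ ^ 2 ≤ 4 * (lowE (embed s ε₀ f₀) + 1) + 1 + 1 ∧ G t = embed s ε f) ∧
      (∀ t ∈ Icc 0 (sharpTime hL (lowE (embed s ε₀ f₀) + 1)), lowE (G t) ≤ 4 * (lowE (embed s ε₀ f₀) + 1)) ∧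
      (∀ t ∈ Icc 0 (sharpTime hL (lowE (embed s ε₀ f₀) + 1)), ∃ (ε tw : ℝ) (φ : SymL2 (Fin 3)) (u : ℝ → SymL2 (Fin 3)),
        0 < ε ∧ KatoLai.IsFormSolution (embed s ε) (klForm hL s ε) φ (winLen hL (show 3 ≤ s by omega) (lowE (embed s ε₀ f₀) + 1)) u ∧
        0 ≤ tw ∧ tw ≤ t ∧ t ≤ tw + winLen hL (show 3 ≤ s by omega) (lowE (embed s ε₀ f₀) + 1) ∧
        (t < sharpTime hL (lowE (embed s ε₀ f₀) + 1) → t < tw + winLen hL (show 3 ≤ s by omega) (lowE (embed s ε₀ f₀) + 1)) ∧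
        (∀ τ ∈ Icc 0 (winLen hL (show 3 ≤ s by omega) (lowE (embed s ε₀ f₀) + 1)), G (tw + τ) = embed s ε (u τ)) ∧
        (∀ τ ∈ Icc 0 (winLen hL (show 3 ≤ s by omega) (lowE (embed s ε₀ f₀) + 1)), ‖u τ‖ ^ 2 ≤ 4 * (lowE (embed s ε₀ f₀) + 1) + 1 + 1)) ∧
      (∀ t ∈ Ioc 0 (sharpTime hL (lowE (embed s ε₀ f₀) + 1)), ∃ (ε tw : ℝ) (φ : SymL2 (Fin 3)) (u : ℝ → SymL2 (Fin 3)),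
        0 < ε ∧ KatoLai.IsFormSolution (embed s ε) (klForm hL s ε) φ (winLen hL (show 3 ≤ s by omega) (lowE (embed s ε₀ f₀) + 1)) u ∧
        0 ≤ tw ∧ tw < t ∧ t ≤ tw + winLen hL (show 3 ≤ s by omega) (lowE (embed s ε₀ f₀) + 1) ∧
        (∀ τ ∈ Icc 0 (winLen hL (show 3 ≤ s by omega) (lowE (embed s ε₀ f₀) + 1)), G (tw + τ) = embed s ε (u τ)) ∧
        (∀ τ ∈ Icc 0 (winLen hL (show 3 ≤ s by omega) (lowE (embed s ε₀ f₀) + 1)), ‖u τ‖ ^ 2 ≤ 4 * (lowE (embed s ε₀ f₀) + 1) + 1 + 1)) := by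
  have hs : 3 ≤ s := by omega
  set Y := lowE (embed s ε₀ f₀) + 1 with hY
  have hYpos : 0 < Y := by have := lowE_nonneg (embed s ε₀ f₀); positivity
  set δ := winLen hL hs Y with hδdef
  have hδ : 0 < δ := winLen_pos hL hs Y
  set Tsh := sharpTime hL Y with hTsh
  have hTsh : 0 < Tsh := sharpTime_pos hL hYpos
  set Mb : ℝ := 4 * Y + 1 + 1 with hMb
  -- the number of windows
  set J : ℕ := ⌈Tsh / δ⌉₊ with hJ
  have hJ1 : Tsh ≤ J * δ := by
    have h := Nat.le_ceil (Tsh / δ)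
    rw [div_le_iff₀ hδ] at h; exact h
  have hJ2 : (J : ℝ) * δ ≤ Tsh + δ := by
    have h := Nat.ceil_lt_add_one (div_nonneg hTsh.le hδ.le)
    rw [← hJ] at h
    have : (J : ℝ) * δ < (Tsh / δ + 1) * δ := mul_lt_mul_of_pos_right h hδ
    rw [add_mul, div_mul_cancel₀ _ hδ.ne', one_mul] at this
    exact this.le
  obtain ⟨G, hG0, hW⟩ := exists_windows hL hs hs7 hε₀ f₀ hQ0 J hJ2
  rw [hG0] at hW
  have hsub : Icc 0 Tsh ⊆ Icc 0 ((J : ℝ) * δ) := Icc_subset_Icc le_rfl hJ1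
  -- windows give representations
  have hrep : ∀ t ∈ Icc 0 Tsh, ∃ (i : ℕ) (ε : ℝ) (φ : SymL2 (Fin 3)) (u : ℝ → SymL2 (Fin 3)), 0 < ε ∧
      KatoLai.IsFormSolution (embed s ε) (klForm hL s ε) φ δ u ∧ (∀ τ ∈ Icc 0 δ, G (i * δ + τ) = embed s ε (u τ)) ∧
      (∀ τ ∈ Icc 0 δ, ‖u τ‖ ^ 2 ≤ Mb) ∧ (i : ℝ) * δ ≤ t ∧ t ≤ i * δ + δ ∧ (t < Tsh → t < i * δ + δ) := by
    intro t ht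
    rcases lt_or_ge t ((J : ℝ) * δ) with hlt | hge
    · obtain ⟨i, hiJ, hit, hti⟩ := exists_window_index hδ ht.1 hlt
      obtain ⟨ε, φ, u, hε, hu, hGi, hbi, -⟩ := hW.win i hiJ
      exact ⟨i, ε, φ, u, hε, hu, hGi, hbi, hit, by linarith, fun _ => by linarith⟩
    · -- `t = Jδ = Tsh`: use the last window (there is one since `Tsh > 0`)
      have hteq : t = J * δ := le_antisymm (ht.2.trans hJ1) hge
      have hJpos : 0 < J := by
        rcases Nat.eq_zero_or_pos J with h | h
        · exfalso; rw [h, Nat.cast_zero, zero_mul] at hJ1; linarith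
        · exact h
      obtain ⟨ε, φ, u, hε, hu, hGi, hbi, -⟩ := hW.win (J - 1) (Nat.sub_lt hJpos one_pos)
      have hcast : ((J - 1 : ℕ) : ℝ) = J - 1 := by rw [Nat.cast_sub hJpos, Nat.cast_one]
      refine ⟨J - 1, ε, φ, u, hε, hu, hGi, hbi, ?_, ?_, fun h => ?_⟩
      · rw [hcast, hteq]; nlinarith
      · rw [hcast, hteq]; linarith
      · exfalso; rw [hteq] at h; linarith [ht.2]
  refine ⟨G, hG0, hW.cont.mono hsub, ⟨?_, ?_, ?_⟩, ?_, ?_, ?_, ?_⟩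
  · -- continuity of the cell path
    exact (cellRestrict hL).continuous.comp_continuousOn (hW.cont.mono hsub)
  · -- no gradient part
    intro t ht
    rcases lt_or_ge t ((J : ℝ) * δ) with hlt | hge
    · obtain ⟨i, hiJ, hit, hti⟩ := exists_window_index hδ ht.1 hlt
      obtain ⟨ε, φ, u, -, -, -, -, hQi⟩ := hW.win i hiJ
      have := hQi (t - i * δ) ⟨by linarith, by linarith⟩
      rwa [show (i : ℝ) * δ + (t - i * δ) = t by ring] at this
    · have hteq : t = J * δ := le_antisymm (ht.2.trans hJ1) hge
      obtain ⟨ε, f, -, -, hQ⟩ := hW.tail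
      rw [hteq]; exact hQ
  · -- right derivatives
    intro t ht
    obtain ⟨i, ε, φ, u, hε, hu, hGi, hbi, hit, -, hti⟩ := hrep t ⟨ht.1, ht.2.le⟩
    have hti' := hti ht.2
    set τ₀ := t - i * δ with hτ₀
    have hτ₀I : τ₀ ∈ Icc 0 δ := ⟨by rw [hτ₀]; linarith, by rw [hτ₀]; linarith⟩
    refine ⟨s, ε, u τ₀, ?_, ?_, ?_⟩
    · rw [hMb] at hbi
      have h := hbi τ₀ hτ₀I
      calc ‖u τ₀‖ = Real.sqrt (‖u τ₀‖ ^ 2) := (Real.sqrt_sq (norm_nonneg _)).symm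
        _ ≤ Real.sqrt (4 * Y + 1 + 1) := Real.sqrt_le_sqrt h
    · have h := hGi τ₀ hτ₀I
      rw [show (i : ℝ) * δ + τ₀ = t by rw [hτ₀]; ring] at h
      rw [h]
    · have hd := hasDerivWithinAt_velCell hL s ε hu hδ.le hτ₀I
      have hsh : HasDerivWithinAt (fun t' : ℝ => t' - i * δ) 1 (Icc ((i : ℝ) * δ) (i * δ + δ)) t := by
        simpa using ((hasDerivAt_id t).sub_const ((i : ℝ) * δ)).hasDerivWithinAt
      have hmaps : MapsTo (fun t' : ℝ => t' - i * δ) (Icc ((i : ℝ) * δ) (i * δ + δ)) (Icc 0 δ) := fun t' ht' =>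
        ⟨by linarith [ht'.1], by linarith [ht'.2]⟩
      have hcomp := hd.scomp t hsh hmaps
      rw [one_smul] at hcomp
      have hmem : Icc ((i : ℝ) * δ) (i * δ + δ) ∈ 𝓝[Ici t] t :=
        mem_of_superset (Icc_mem_nhdsGE hti') (Icc_subset_Icc hit le_rfl)
      refine (hcomp.mono_of_mem_nhdsWithin hmem).congr_of_eventuallyEq ?_ ?_
      · filter_upwards [hmem] with t' ht'
        have h := hGi (t' - i * δ) (hmaps ht')
        rw [show (i : ℝ) * δ + (t' - i * δ) = t' by ring] at h
        show cellRestrict hL (G t') = velCell hL s ε u (t' - i * δ)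
        rw [h]; rfl
      · have h := hGi τ₀ hτ₀I
        rw [show (i : ℝ) * δ + τ₀ = t by rw [hτ₀]; ring] at h
        show cellRestrict hL (G t) = velCell hL s ε u (t - i * δ)
        rw [h]; rfl
  · -- level-`s` representation
    intro t ht
    obtain ⟨i, ε, φ, u, hε, hu, hGi, hbi, hit, hti, -⟩ := hrep t ht
    have hτI : t - i * δ ∈ Icc 0 δ := ⟨by linarith, by linarith⟩
    refine ⟨ε, u (t - i * δ), hε, hbi _ hτI, ?_⟩
    have h := hGi (t - i * δ) hτI
    rwa [show (i : ℝ) * δ + (t - i * δ) = t by ring] at h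
  · -- level-`3` energy
    intro t ht
    have h := hW.lowE_le hL hδ hs7 (hsub ht) (by rw [hG0]; exact ht.2)
    rwa [hG0] at h
  · -- the raw windows (to the right)
    intro t ht
    obtain ⟨i, ε, φ, u, hε, hu, hGi, hbi, hit, hti, hlt⟩ := hrep t ht
    exact ⟨ε, i * δ, φ, u, hε, hu, by positivity, hit, hti, hlt, hGi, hbi⟩
  · -- the raw windows (to the left)
    intro t ht
    obtain ⟨i, hiJ, hit, hti⟩ := exists_window_index_left hδ ht.1 (ht.2.trans hJ1)
    obtain ⟨ε, φ, u, hε, hu, hGi, hbi, -⟩ := hW.win i hiJ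
    exact ⟨ε, i * δ, φ, u, hε, hu, by positivity, hit, by linarith, hGi, hbi⟩

end Final

end PeriodicCylinder

end Literature.Analysis.FluidPDE
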